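import Literature.MathematicalPhysics.QuantumFieldTheory.Balaban1983to89.Node00.TransportOfRecordGaugeFixing
import Literature.MathematicalPhysics.QuantumFieldTheory.Balaban1983to89.Node00.TkNoExpansionStepZero

/-!
# DAG node N11 — THE FINE-GAUGE ORBIT AVERAGE UNDER THE δ-FUNCTION: def-T's one-step transport (†) reads a NON-invariant factor of its integrand
# (the step weight `w(s′)(U,V′)` ∋ (3.3)'s `χ′_k`) ONLY through its uniform average over the fine gauge group `{u : u(emb y) = 1, y ∈ T^{(k+1)}}`

HEADER — WORK-UNIT METADATA.  Cell `pub-ymgap`, YM-PLAN Track A (HUMAN RULING D-0062), R134 fan-out seat `pub-ymgap-dag-n11-e` (g31) on node N11 [B14]; route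
`BalabanUVNodes`, key K1⁹ = stmt-QuantumFields-27364 (helper, `--kind proof --supports 27364 --as helper`, count-neutral).  [I] = [Balaban1987RG1] (CMP 109),
[III] = [Balaban1988Convergent] (CMP 119).  Over, BY NAME and unmodified: this seat's g22 `Node00/TransportOfRecordGaugeFixing` (§1 the a.e.-uniqueness principle
`kernelTransport_ae_eq_of_forall_integral_mul_comp_eq'`, `avOfRecord_gaugeAct_of_fineGauge`), pv28∕gen 16's `B12FaddeevPopov016` (`fineTransf`, `fineGauge_fineTransf`,
`integral_comp_gaugeAct` — the fine gauge group parametrised by the product group over the non-centre sites `FPIdx`), 11a's `Node00/TkNoExpansionStepZero`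
(`transportK_congr_ae_of_fibre`), def-T's `Node00/TStepOfRecord` (`texpASucc`, `transportOfRecord`), `DatumAvLayer` (`avOfRecord_measurable ∕ _haarAC`, `rhoZeroOfRecord`).

WHY (a reading of def-T's (†) prompted by dag-n11-d g18's `…N11TopPairNewAction.firstStep_O3_top_iff_explicit`, whose OLD side is
`∫dU δ(ŪV′⁻¹)[χ′_0(ALL)(U,V′)·Σ_S ζ_1(∅,∅,(∅,S))(U,V′)·ρ₀(U)](V′)`).  def-T's value-level T-step (†) `(𝐓e^A)_{k+1}(s′)(V′) = ∫dU δ(ŪV′⁻¹)[w(s′)(U,V′)·χ_k·(𝐓e^A)_k]`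
integrates the RAW Haar fibre `{Ū = V′}`; `dU`, `Ū` and the old factor `χ_k·(𝐓e^A)_k` (at `k = 0`: `ρ₀ = e^{−E}e^{−A∕g₀²}`) are invariant under the fine gauge group, the step
weight `w(s′)` is NOT — its (3.3) factor `χ′_k` (`B14.Sect3Decomp.chiPrime`: `|V_k(b)(V^{(k)}_□(V′)(b))⁻¹ − 1| < 2δ_k` bondwise) compares the fine field with a background that
does not co-move.  THIS FILE proves what (†) then does with such a factor: NOTHING but average it over the fine gauge orbit.  Print reads (3.3) differently: [III] p.265
L.8–12 «in the complement (P″_{k+1} ∪ Z_k^{∼5})ᶜ we introduce the axial gauge fixing as in (1.5), with V_k, ε_k, g_k … We get an expansion of the form (1.6) … Next … we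
introduce the decomposition of unity restricting the approximate fluctuation fields (3.3)» — (3.3) is inserted UNDER (1.6), next to [I] (0.19)'s Faddeev–Popov factor
`χ_Ax·e^{−G(V_k)∕g_k²}∕zⁿ`, so print's term reads `χ′_k` through the FP-WEIGHTED orbit average (concentrated at the block axial gauge), (†)'s through the UNIFORM one.  This
seat's g22 `Node00/TStepOfRecordGaugeFixing` showed the FP factor immaterial under (†) UNDER THE DISPLAYED HYPOTHESIS `hwinv` «every `w(s′)(·,V′)` fine-gauge invariant»;
that hypothesis is not met by a weight carrying `χ′_k` — the present law is the one that applies without it.  (Design consequence for the type owner, NOT decided here: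
where (1.5)'s factor enters (†) ∕ `wOfRecord`; def-T's pointwise `IsStepUnity` and `|w| ≤ 1` exclude carrying it inside `w`.)

WHAT THIS FILE PROVES (0 `def`, 0 `sorry`, standard axioms; the orbit average `f^{av}(U) := ∫ ∏_{(y,x)} dg f(U^{u_g})`, `u_g = fineTransf g`, is SPELLED OUT).
§1 generic level `j` (`RegularGaugeGroup` with Haar data, standard Borel; `Ū` measurable, `HaarAC`, fine-gauge invariant; `ρ` fine-gauge-invariant integrable; `f` BOUNDED
   MEASURABLE, not invariant): `measurable_fineTransf_apply` · `measurable_gaugeAct_fineTransf` · `integral_comp_gaugeAct_mul_mul_comp_avg` (`∫ f(U^u)ρ(U)h(ŪU)dU = ∫ fρ(h∘Ū)dU`,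
   fine `u`) · `measurable_fineOrbitAvg` · `abs_fineOrbitAvg_le` · `integral_fineOrbitAvg_mul_mul_comp_avg` (Fubini over the fine gauge group) · `integrable_fineOrbitAvg_mul` ·
   ★★ `transportK_comp_gaugeAct_mul_ae_eq` (`∫dU δ(ŪV⁻¹)[f(U^u)ρ] =ᵐ ∫dU δ(ŪV⁻¹)[fρ]`) · ★★★ `transportK_mul_ae_eq_transportK_fineOrbitAvg_mul` (`∫dU δ(ŪV⁻¹)[fρ] =ᵐ ∫dU δ(ŪV⁻¹)[f^{av}ρ]`).
§2 `V`-dependent factors on the diagonal ((†)'s shape): ★★ `transportK_family_mul_ae_eq_fineOrbitAvg` · `ae_imp_transportK_family_eq_iff_fineOrbitAvg` (an a.e. clause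
   «`χ(V) ≠ 0 → ∫dU δ(ŪV⁻¹)[f(·,V)ρ](V) = 𝒩(V)`» holds iff it holds with `f ↦ f^{av}`).
§3 def-T's generic `texpASucc`: ★★★ `texpASucc_ae_eq_texpASucc_fineOrbitAvg` — replacing the step weight by its fine-gauge orbit average moves (†) only on a `dV′`-null set.
§4 at the record (`SU(N)`, `avOfRecord`, `k < K`): ★★ `transportOfRecord_comp_gaugeAct_mul_ae_eq` · ★★★ `transportOfRecord_mul_ae_eq_fineOrbitAvg_mul` ·
   ★★★ `transportOfRecord_family_mul_ae_eq_fineOrbitAvg` · `ae_imp_transportOfRecord_family_eq_iff_fineOrbitAvg` · `fineGaugeInvariant_rhoZeroOfRecord`.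
The top pair of the Stage-13 record (dag-n11-d's letters) is the sibling file `…N11TopPairOldSideFineGaugeOrbitAverage`.

HONEST FRAMING.  Helper lane of K1⁹, count-neutral; [folklore] measure theory (Haar invariance + Fubini + a.e. uniqueness of the disintegration transport) composed BY
NAME with landed bookkeeping; nothing of Bałaban's ESTIMATES asserted; no identity of print asserted or refuted; (O3′) ∕ Thm 1 ∕ Thm 2 NOT touched; N11 NOT discharged;
K1⁹ NOT closed; counts unmoved (typed 28∕28 · discharged 5∕27).  One finite four-torus programme at fixed `ε = L^{−K}` — NOT ℝ⁴, NOT OS, NOT a mass gap, NOT Clay.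
No `sorry`, `axiom`, `def`, `instance`, `notation`.  Sources (SHAPE ∕ bookkeeping only): [III] (1.5)–(1.6) p.247, (3.1) p.264, (3.3) p.265 with L.8–12, (3.24)–(3.25) p.270;
[I] (0.13)–(0.16) pp.254–255, (0.19) p.255; [Balaban1985Averaging] (10) p.19.
-/

noncomputable section

open MeasureTheory Function
open scoped ENNReal BigOperators

namespace Summit.QuantumFields.YangMills.Theorems.BalabanUVNodesN11TransportFineGaugeOrbitAverage

open Literature.MathematicalPhysics.QuantumFieldTheory.Balaban1983to89
open GaugeField (gaugeAct)
open T4AveragingDisintegration (kernelTransport transportK)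
open T4FiniteEpsInhabited (HaarAC)
open B12FaddeevPopov016 (FineGauge FineGaugeInvariant FPIdx fineTransf fineGauge_fineTransf integral_comp_gaugeAct)
open B12RTGaugeInvariance254 (measurable_gaugeAct)
open Node00 (kernelTransport_ae_eq_of_forall_integral_mul_comp_eq' transportK_congr_ae_of_fibre)

/-! ## §1  Generic level `j`: the fine gauge group does not move `∫dU δ(ŪV⁻¹)[f·ρ]` -/

section Generic

variable {P : Params} {j : ℕ} {G : Type*} [GaugeGroup G] [MeasurableSpace G] [HaarData G] [RegularGaugeGroup G]

omit [HaarData G] [RegularGaugeGroup G] in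
/-- The fine gauge transformation `fineTransf g` built from a family `g` of group elements at the non-centre sites depends measurably on `g`,
site by site (a coordinate projection or the constant `1`). [folklore] -/
theorem measurable_fineTransf_apply (x : Site P j) : Measurable fun g : FPIdx P j → G => fineTransf g x := by
  by_cases h : x ∈ (block (blockOf x)).erase (emb (blockOf x))
  · have : (fun g : FPIdx P j → G => fineTransf g x) = fun g => g ⟨blockOf x, ⟨x, h⟩⟩ := by
      funext g; simp only [fineTransf, dif_pos h]
    rw [this]; exact measurable_pi_apply _
  · have : (fun g : FPIdx P j → G => fineTransf g x) = fun _ => 1 := by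
      funext g; simp only [fineTransf, dif_neg h]
    rw [this]; exact measurable_const

omit [HaarData G] in
/-- The fine gauge action `(U, g) ↦ U^{u_g}` is jointly measurable. [folklore] -/
theorem measurable_gaugeAct_fineTransf :
    Measurable fun p : GaugeField P j G × (FPIdx P j → G) => gaugeAct (fineTransf p.2) p.1 := by
  refine measurable_pi_lambda _ fun b => ?_
  show Measurable fun p : GaugeField P j G × (FPIdx P j → G) => fineTransf p.2 b.src * p.1 b * (fineTransf p.2 b.tgt)⁻¹
  have h1 : Measurable fun p : GaugeField P j G × (FPIdx P j → G) => fineTransf p.2 b.src :=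
    (measurable_fineTransf_apply b.src).comp measurable_snd
  have h2 : Measurable fun p : GaugeField P j G × (FPIdx P j → G) => p.1 b := (measurable_pi_apply b).comp measurable_fst
  have h3 : Measurable fun p : GaugeField P j G × (FPIdx P j → G) => fineTransf p.2 b.tgt :=
    (measurable_fineTransf_apply b.tgt).comp measurable_snd
  exact (h1.mul h2).mul h3.inv

omit [RegularGaugeGroup G] in
/-- **THE PAIRING IS BLIND TO A FINE GAUGE TRANSFORMATION OF A NON-INVARIANT FACTOR**: for `ρ` fine-gauge-invariant, `Ū` invariant under the fine gauge
group, a fine `u` and ANY `f`, `h`: `∫dU f(U^u) ρ(U) h(Ū U) = ∫dU f(U) ρ(U) h(Ū U)` (invariance of `dU`, `ρ`, `Ū`; no measurability needed).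
[cite: Balaban1985Averaging, (10) p.19; Balaban1987RG1, (0.13) p.254] -/
theorem integral_comp_gaugeAct_mul_mul_comp_avg [MeasurableMul₂ G] {avg : GaugeField P j G → GaugeField P (j + 1) G}
    (havgInv : ∀ u : GaugeTransf P j G, FineGauge u → ∀ U, avg (gaugeAct u U) = avg U)
    {ρ : Density P j G} (hρ : FineGaugeInvariant ρ) (f : GaugeField P j G → ℝ) (h : GaugeField P (j + 1) G → ℝ)
    {u : GaugeTransf P j G} (hu : FineGauge u) :
    ∫ U, f (gaugeAct u U) * ρ U * h (avg U) ∂fieldMeasure P j G = ∫ U, f U * ρ U * h (avg U) ∂fieldMeasure P j G := by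
  have key := integral_comp_gaugeAct u (fun U : GaugeField P j G => f U * ρ U * h (avg U))
  simp only [hρ u hu, havgInv u hu] at key
  exact key

omit [RegularGaugeGroup G] in
/-- A bounded measurable factor times an integrable density is integrable. [folklore] -/
private theorem integrable_bdd_mul {f ρ : GaugeField P j G → ℝ} (hfm : Measurable f) {C : ℝ} (hfb : ∀ U, |f U| ≤ C)
    (hρi : Integrable ρ (fieldMeasure P j G)) : Integrable (fun U => f U * ρ U) (fieldMeasure P j G) :=
  hρi.bdd_mul hfm.aestronglyMeasurable (Filter.Eventually.of_forall fun U => by rw [Real.norm_eq_abs]; exact hfb U)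


/-- The fine-gauge ORBIT AVERAGE `U ↦ ∫ ∏dg f(U^{u_g})` of a bounded measurable `f` is measurable … [folklore] -/
theorem measurable_fineOrbitAvg {f : GaugeField P j G → ℝ} (hfm : Measurable f) :
    Measurable fun U : GaugeField P j G =>
      ∫ g, f (gaugeAct (fineTransf g) U) ∂Measure.pi (fun _ : FPIdx P j => (HaarData.haar : Measure G)) := by
  haveI : IsProbabilityMeasure (HaarData.haar : Measure G) := HaarData.isProb
  have hF : StronglyMeasurable (uncurry fun (U : GaugeField P j G) (g : FPIdx P j → G) => f (gaugeAct (fineTransf g) U)) :=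
    (hfm.comp measurable_gaugeAct_fineTransf).stronglyMeasurable
  exact (hF.integral_prod_right (ν := Measure.pi (fun _ : FPIdx P j => (HaarData.haar : Measure G)))).measurable

omit [RegularGaugeGroup G] in
/-- … and bounded by the same constant. [folklore] -/
theorem abs_fineOrbitAvg_le {f : GaugeField P j G → ℝ} {C : ℝ} (hfb : ∀ U, |f U| ≤ C) (U : GaugeField P j G) :
    |∫ g, f (gaugeAct (fineTransf g) U) ∂Measure.pi (fun _ : FPIdx P j => (HaarData.haar : Measure G))| ≤ C := by
  haveI : IsProbabilityMeasure (HaarData.haar : Measure G) := HaarData.isProb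
  have h := norm_integral_le_of_norm_le_const (μ := Measure.pi (fun _ : FPIdx P j => (HaarData.haar : Measure G)))
    (f := fun g => f (gaugeAct (fineTransf g) U)) (C := C) (Filter.Eventually.of_forall fun g => by
      rw [Real.norm_eq_abs]; exact hfb _)
  simpa [Real.norm_eq_abs] using h

/-- **THE PAIRING SEES ONLY THE FINE-GAUGE ORBIT AVERAGE** (Fubini over the product Haar measure of the fine gauge group, then §1's blindness bond by bond):
`∫dU [∫∏dg f(U^{u_g})] ρ(U) h(Ū U) = ∫dU f(U) ρ(U) h(Ū U)` for bounded measurable `f`, `h`, fine-gauge-invariant integrable measurable `ρ`.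
[cite: Balaban1987RG1, (0.13)–(0.16) pp.254–255; Balaban1985Averaging, (10) p.19] -/
theorem integral_fineOrbitAvg_mul_mul_comp_avg (hj : j + 1 ≤ P.m + P.K) {avg : GaugeField P j G → GaugeField P (j + 1) G}
    (havg : Measurable avg) (havgInv : ∀ u : GaugeTransf P j G, FineGauge u → ∀ U, avg (gaugeAct u U) = avg U)
    {ρ : Density P j G} (hρ : FineGaugeInvariant ρ) (hρi : Integrable ρ (fieldMeasure P j G))
    {f : GaugeField P j G → ℝ} (hfm : Measurable f) {C : ℝ} (hfb : ∀ U, |f U| ≤ C)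
    {h : GaugeField P (j + 1) G → ℝ} (hh : Measurable h) {C' : ℝ} (hhb : ∀ V, |h V| ≤ C') :
    ∫ U, (∫ g, f (gaugeAct (fineTransf g) U) ∂Measure.pi (fun _ : FPIdx P j => (HaarData.haar : Measure G))) * ρ U * h (avg U)
        ∂fieldMeasure P j G =
      ∫ U, f U * ρ U * h (avg U) ∂fieldMeasure P j G := by
  haveI : IsProbabilityMeasure (HaarData.haar : Measure G) := HaarData.isProb
  set η : Measure (FPIdx P j → G) := Measure.pi fun _ => (HaarData.haar : Measure G) with hη
  set F : GaugeField P j G → (FPIdx P j → G) → ℝ := fun U g => f (gaugeAct (fineTransf g) U) * (ρ U * h (avg U)) with hF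
  -- pull the two `U`-factors under the `g`-integral
  have h1 : ∀ U : GaugeField P j G, (∫ g, f (gaugeAct (fineTransf g) U) ∂η) * ρ U * h (avg U) = ∫ g, F U g ∂η := by
    intro U
    simp only [hF]
    rw [integral_mul_const, mul_assoc]
  simp_rw [h1]
  -- Fubini
  have hF_int : Integrable (uncurry F) ((fieldMeasure P j G).prod η) := by
    have ha : Integrable (fun p : GaugeField P j G × (FPIdx P j → G) => ρ p.1 * h (avg p.1)) ((fieldMeasure P j G).prod η) := by
      have hi : Integrable (fun U => ρ U * h (avg U)) (fieldMeasure P j G) :=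
        hρi.mul_bdd (hh.comp havg).aestronglyMeasurable
          (Filter.Eventually.of_forall fun U => by rw [Real.norm_eq_abs]; exact hhb (avg U))
      exact hi.comp_fst η
    have hb_meas : Measurable fun p : GaugeField P j G × (FPIdx P j → G) => f (gaugeAct (fineTransf p.2) p.1) :=
      hfm.comp measurable_gaugeAct_fineTransf
    have hb_bdd : ∀ p : GaugeField P j G × (FPIdx P j → G), ‖f (gaugeAct (fineTransf p.2) p.1)‖ ≤ C := fun p => by
      rw [Real.norm_eq_abs]; exact hfb _
    have hprod := ha.bdd_mul hb_meas.aestronglyMeasurable (Filter.Eventually.of_forall hb_bdd)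
    refine hprod.congr (Filter.Eventually.of_forall fun p => ?_)
    simp only [hF, uncurry]
  rw [integral_integral_swap hF_int]
  -- for fixed `g` the `U`-integral does not depend on `g`
  have h4 : ∀ g : FPIdx P j → G, ∫ U, F U g ∂fieldMeasure P j G = ∫ U, f U * ρ U * h (avg U) ∂fieldMeasure P j G := by
    intro g
    have hpt : ∀ U, F U g = f (gaugeAct (fineTransf g) U) * ρ U * h (avg U) := fun U => by simp only [hF, mul_assoc]
    simp_rw [hpt]
    exact integral_comp_gaugeAct_mul_mul_comp_avg havgInv hρ f h (fineGauge_fineTransf hj g)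
  simp_rw [h4]
  rw [integral_const, hη]
  simp

/-- An integrable fine-gauge-invariant density times the orbit average of a bounded measurable factor is integrable. [folklore] -/
theorem integrable_fineOrbitAvg_mul {ρ : Density P j G} (hρi : Integrable ρ (fieldMeasure P j G))
    {f : GaugeField P j G → ℝ} (hfm : Measurable f) {C : ℝ} (hfb : ∀ U, |f U| ≤ C) :
    Integrable (fun U => (∫ g, f (gaugeAct (fineTransf g) U) ∂Measure.pi (fun _ : FPIdx P j => (HaarData.haar : Measure G))) * ρ U)
      (fieldMeasure P j G) :=
  integrable_bdd_mul (measurable_fineOrbitAvg hfm) (abs_fineOrbitAvg_le hfb) hρi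

variable [StandardBorelSpace G]

/-- ★★ **def-T's (†) IS BLIND TO FINE GAUGE TRANSFORMATIONS OF A NON-INVARIANT FACTOR.**  For an averaging `Ū` that is measurable, `HaarAC` and invariant
under the fine gauge group, a fine-gauge-invariant integrable `ρ`, a bounded measurable `f` (NOT assumed invariant) and a fine `u`:
`∫dU δ(ŪV⁻¹)[f(U^u)·ρ(U)] = ∫dU δ(ŪV⁻¹)[f(U)·ρ(U)]` for `dV`-a.e. `V` (one-step kernel transports; a.e. uniqueness from the pairing identity).
[cite: Balaban1988Convergent, (3.1) p.264; Balaban1987RG1, (0.13) p.254] -/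
theorem transportK_comp_gaugeAct_mul_ae_eq {avg : GaugeField P j G → GaugeField P (j + 1) G} (havg : Measurable avg) (hac : HaarAC avg)
    (havgInv : ∀ u : GaugeTransf P j G, FineGauge u → ∀ U, avg (gaugeAct u U) = avg U)
    {ρ : Density P j G} (hρ : FineGaugeInvariant ρ) (hρi : Integrable ρ (fieldMeasure P j G))
    {f : GaugeField P j G → ℝ} (hfm : Measurable f) {C : ℝ} (hfb : ∀ U, |f U| ≤ C) {u : GaugeTransf P j G} (hu : FineGauge u) :
    transportK avg (fun U => f (gaugeAct u U) * ρ U) =ᵐ[fieldMeasure P (j + 1) G] transportK avg (fun U => f U * ρ U) := by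
  refine kernelTransport_ae_eq_of_forall_integral_mul_comp_eq' (fieldMeasure P j G) (fieldMeasure P (j + 1) G) havg hac
    (integrable_bdd_mul (hfm.comp (measurable_gaugeAct u)) (fun U => hfb _) hρi) (integrable_bdd_mul hfm hfb hρi) fun h _ _ => ?_
  exact integral_comp_gaugeAct_mul_mul_comp_avg havgInv hρ f h hu

/-- ★★★ **THE FINE-GAUGE ORBIT-AVERAGE LAW OF THE ONE-STEP TRANSPORT.**  For an averaging `Ū` (measurable, `HaarAC`, invariant under the fine gauge group
`u(y) = 1`, `y ∈ T^{(j+1)}`), a fine-gauge-invariant integrable measurable `ρ` and a bounded measurable factor `f` that need NOT be invariant: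
`∫dU δ(ŪV⁻¹)[f(U)·ρ(U)] = ∫dU δ(ŪV⁻¹)[f^{av}(U)·ρ(U)]` for `dV`-a.e. `V`, `f^{av}(U) := ∫ ∏_{(y,x)} dg(y,x) f(U^{u_g})` the average of `f` over the fine gauge orbit
of `U` (product Haar measure over the non-centre sites, `u_g = fineTransf g`).  The δ-function integral of (3.1)∕(0.13) cannot distinguish a non-invariant factor
from its orbit average. [cite: Balaban1988Convergent, (3.1) p.264, (1.5)–(1.6) p.247; Balaban1987RG1, (0.13)–(0.16) pp.254–255] -/
theorem transportK_mul_ae_eq_transportK_fineOrbitAvg_mul (hj : j + 1 ≤ P.m + P.K) {avg : GaugeField P j G → GaugeField P (j + 1) G}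
    (havg : Measurable avg) (hac : HaarAC avg) (havgInv : ∀ u : GaugeTransf P j G, FineGauge u → ∀ U, avg (gaugeAct u U) = avg U)
    {ρ : Density P j G} (hρ : FineGaugeInvariant ρ) (hρi : Integrable ρ (fieldMeasure P j G))
    {f : GaugeField P j G → ℝ} (hfm : Measurable f) {C : ℝ} (hfb : ∀ U, |f U| ≤ C) :
    transportK avg (fun U => f U * ρ U) =ᵐ[fieldMeasure P (j + 1) G]
      transportK avg (fun U =>
        (∫ g, f (gaugeAct (fineTransf g) U) ∂Measure.pi (fun _ : FPIdx P j => (HaarData.haar : Measure G))) * ρ U) := by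
  refine kernelTransport_ae_eq_of_forall_integral_mul_comp_eq' (fieldMeasure P j G) (fieldMeasure P (j + 1) G) havg hac
    (integrable_bdd_mul hfm hfb hρi) (integrable_fineOrbitAvg_mul hρi hfm hfb) fun h hh hC => ?_
  obtain ⟨C', hC'⟩ := hC
  exact (integral_fineOrbitAvg_mul_mul_comp_avg hj havg havgInv hρ hρi hfm hfb hh hC').symm

end Generic

/-! ## §2  Coarse-field-dependent factors on the diagonal: def-T's `texpASucc` shape `V ↦ ∫dU δ(ŪV⁻¹)[f(U,V)·ρ(U)](V)` -/

section Family

variable {P : Params} {j : ℕ} {G : Type*} [GaugeGroup G] [MeasurableSpace G] [HaarData G] [RegularGaugeGroup G] [StandardBorelSpace G]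

/-- ★★ **THE ORBIT-AVERAGE LAW FOR A `V`-DEPENDENT FACTOR ON THE DIAGONAL** (the shape of def-T's (†) `texpASucc`, whose integrand `w(s′)(U,V′)·(…)(U)`
reads the coarse field): for `f(U,V)` jointly measurable and bounded and `ρ` fine-gauge-invariant integrable measurable,
`∫dU δ(ŪV⁻¹)[f(U,V)·ρ(U)](V) = ∫dU δ(ŪV⁻¹)[f^{av}(U,V)·ρ(U)](V)` for `dV`-a.e. `V`, `f^{av}(U,V) := ∫∏dg f(U^{u_g},V)` (on the fibre `Ū = V` the factor is the
SINGLE density `U ↦ f(U, Ū U)` — def-T's `transportK_congr_ae_of_fibre` — to which §1 applies; `Ū(U^{u_g}) = Ū U` brings the average back to the diagonal).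
[cite: Balaban1988Convergent, (3.1) p.264, (3.3) p.265; Balaban1987RG1, (0.13)–(0.16) pp.254–255] -/
theorem transportK_family_mul_ae_eq_fineOrbitAvg (hj : j + 1 ≤ P.m + P.K) {avg : GaugeField P j G → GaugeField P (j + 1) G}
    (havg : Measurable avg) (hac : HaarAC avg) (havgInv : ∀ u : GaugeTransf P j G, FineGauge u → ∀ U, avg (gaugeAct u U) = avg U)
    {ρ : Density P j G} (hρ : FineGaugeInvariant ρ) (hρi : Integrable ρ (fieldMeasure P j G))
    {f : GaugeField P j G → GaugeField P (j + 1) G → ℝ} (hfm : Measurable fun p : GaugeField P j G × GaugeField P (j + 1) G => f p.1 p.2)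
    {C : ℝ} (hfb : ∀ U V, |f U V| ≤ C) :
    (fun V => transportK avg (fun U => f U V * ρ U) V) =ᵐ[fieldMeasure P (j + 1) G]
      fun V => transportK avg (fun U =>
        (∫ g, f (gaugeAct (fineTransf g) U) V ∂Measure.pi (fun _ : FPIdx P j => (HaarData.haar : Measure G))) * ρ U) V := by
  -- (a) on the fibre the factor is the single density `U ↦ f(U, Ū U)`
  have hA := transportK_congr_ae_of_fibre havg hac (f := fun V U => f U V * ρ U) (g := fun _ U => f U (avg U) * ρ U) fun U => rfl
  -- (b) §1 for that density
  have hF0m : Measurable fun U : GaugeField P j G => f U (avg U) := hfm.comp (measurable_id.prodMk havg)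
  have hB := transportK_mul_ae_eq_transportK_fineOrbitAvg_mul hj havg hac havgInv hρ hρi hF0m (C := C) fun U => hfb U (avg U)
  -- (c) `Ū(U^{u_g}) = Ū U` under the orbit integral, then back to the diagonal
  have hC' : (fun U : GaugeField P j G =>
      (∫ g, f (gaugeAct (fineTransf g) U) (avg (gaugeAct (fineTransf g) U)) ∂Measure.pi (fun _ : FPIdx P j => (HaarData.haar : Measure G))) * ρ U) =
      fun U => (∫ g, f (gaugeAct (fineTransf g) U) (avg U) ∂Measure.pi (fun _ : FPIdx P j => (HaarData.haar : Measure G))) * ρ U := by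
    funext U
    simp_rw [havgInv _ (fineGauge_fineTransf hj _)]
  rw [hC'] at hB
  have hD := transportK_congr_ae_of_fibre havg hac
    (f := fun _ U => (∫ g, f (gaugeAct (fineTransf g) U) (avg U) ∂Measure.pi (fun _ : FPIdx P j => (HaarData.haar : Measure G))) * ρ U)
    (g := fun V U => (∫ g, f (gaugeAct (fineTransf g) U) V ∂Measure.pi (fun _ : FPIdx P j => (HaarData.haar : Measure G))) * ρ U)
    fun U => rfl
  filter_upwards [hA, hB, hD] with V hVA hVB hVD
  rw [hVA, hVB, hVD]

/-- **THE SAME AGAINST ANY RIGHT-HAND SIDE**: an a.e. identity «`∫dU δ(ŪV⁻¹)[f(U,V)ρ(U)](V) = N(V)` for a.e. `V` with `χ(V) ≠ 0`» holds IFF it holds with `f` replaced by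
its fine-gauge orbit average — the form in which def-T's (O3′)-type clauses constrain the step weight. [cite: Balaban1988Convergent, (3.1) p.264, (3.25) p.270] -/
theorem ae_imp_transportK_family_eq_iff_fineOrbitAvg (hj : j + 1 ≤ P.m + P.K) {avg : GaugeField P j G → GaugeField P (j + 1) G}
    (havg : Measurable avg) (hac : HaarAC avg) (havgInv : ∀ u : GaugeTransf P j G, FineGauge u → ∀ U, avg (gaugeAct u U) = avg U)
    {ρ : Density P j G} (hρ : FineGaugeInvariant ρ) (hρi : Integrable ρ (fieldMeasure P j G))
    {f : GaugeField P j G → GaugeField P (j + 1) G → ℝ} (hfm : Measurable fun p : GaugeField P j G × GaugeField P (j + 1) G => f p.1 p.2)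
    {C : ℝ} (hfb : ∀ U V, |f U V| ≤ C) (χ N : GaugeField P (j + 1) G → ℝ) :
    (∀ᵐ V ∂fieldMeasure P (j + 1) G, χ V ≠ 0 → transportK avg (fun U => f U V * ρ U) V = N V) ↔
      ∀ᵐ V ∂fieldMeasure P (j + 1) G, χ V ≠ 0 →
        transportK avg (fun U =>
          (∫ g, f (gaugeAct (fineTransf g) U) V ∂Measure.pi (fun _ : FPIdx P j => (HaarData.haar : Measure G))) * ρ U) V = N V := by
  have h := transportK_family_mul_ae_eq_fineOrbitAvg hj havg hac havgInv hρ hρi hfm hfb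
  constructor
  · intro h1
    filter_upwards [h, h1] with V hV hV1
    rw [← hV]; exact hV1
  · intro h1
    filter_upwards [h, h1] with V hV hV1
    rw [hV]; exact hV1

end Family

/-! ## §3  def-T's GENERIC value-level T-step (†) `texpASucc`: the step weight is read only through its fine-gauge orbit average -/

section TStep

open B14.Eq218Concrete (Seq)
open Node00 (texpASucc tstepIntegrand)

variable {P : Params} {G : Type*} [GaugeGroup G] [MeasurableSpace G] [HaarData G] [RegularGaugeGroup G] [StandardBorelSpace G]
variable {α : Type*} {D : ℕ → Set (Set α)} {k : ℕ}

/-- ★★★ **def-T's (†) READS ITS STEP WEIGHT ONLY THROUGH THE FINE-GAUGE ORBIT AVERAGE.**  For the value-level T-step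
`(𝐓e^A)_{k+1}(s′)(V′) = ∫dU δ(ŪV′⁻¹)[w(s′)(U,V′)·χ_k(init s′)(U)·(𝐓e^A)_k(init s′)(U)]` (`Node00.TStepOfRecord.texpASucc`) along an averaging `Ū` (measurable, `HaarAC`,
invariant under the fine gauge group), with a fine-gauge-invariant integrable old factor `χ_k(init s′)·(𝐓e^A)_k(init s′)` and a jointly measurable bounded step weight `w(s′)`
— NOT assumed invariant —: replacing `w(s′)(U,V′)` by its orbit average `∫∏dg w(s′)(U^{u_g},V′)` over the fine gauge group changes `(𝐓e^A)_{k+1}(s′)` only on a `dV′`-null set.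
[cite: Balaban1988Convergent, (3.1) p.264, (3.3) p.265, (3.24)–(3.25) p.270; Balaban1987RG1, (0.13)–(0.16) pp.254–255] -/
theorem texpASucc_ae_eq_texpASucc_fineOrbitAvg (hk : k + 1 ≤ P.m + P.K) {avg : GaugeField P k G → GaugeField P (k + 1) G}
    (havg : Measurable avg) (hac : HaarAC avg) (havgInv : ∀ u : GaugeTransf P k G, FineGauge u → ∀ U, avg (gaugeAct u U) = avg U)
    (χk T : Seq D k → Density P k G) (w : Seq D (k + 1) → GaugeField P k G → GaugeField P (k + 1) G → ℝ) (s' : Seq D (k + 1))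
    (hold : FineGaugeInvariant (fun U => χk s'.init U * T s'.init U))
    (holdi : Integrable (fun U => χk s'.init U * T s'.init U) (fieldMeasure P k G))
    (hwm : Measurable fun p : GaugeField P k G × GaugeField P (k + 1) G => w s' p.1 p.2) {C : ℝ} (hwb : ∀ U V, |w s' U V| ≤ C) :
    texpASucc avg χk T w s' =ᵐ[fieldMeasure P (k + 1) G]
      texpASucc avg χk T (fun s U V => ∫ g, w s (gaugeAct (fineTransf g) U) V ∂Measure.pi (fun _ : FPIdx P k => (HaarData.haar : Measure G))) s' :=
  transportK_family_mul_ae_eq_fineOrbitAvg hk havg hac havgInv hold holdi hwm hwb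

end TStep

/-! ## §4  AT THE RECORD: `G = SU(N)`, the torus `F.P K`, def-T's `transportOfRecord F N K k` along `avOfRecord F N K k`, `k < K` -/

section Record

open T4Continuum (T4Family)
open Node00

variable (F : T4Family) (N : ℕ) [NeZero N]

/-- The standing range `k + 1 ≤ m + K` of the `K`-th torus from `k < K` (bookkeeping). [folklore] -/
private theorem succ_le_m_add_K_of_lt {K k : ℕ} (hk : k < K) : k + 1 ≤ (F.P K).m + (F.P K).K := by
  simp only [T4Family.P_K, T4Family.P_m]; omega

/-- ★★ **THE TRANSPORT OF RECORD IS BLIND TO FINE GAUGE TRANSFORMATIONS OF A NON-INVARIANT FACTOR**: for `k < K`, a fine-gauge-invariant integrable `ρ`, a bounded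
measurable `f` and a fine `u` (`u(emb y) = 1`): `transportOfRecord k (f(·^u)·ρ) = transportOfRecord k (f·ρ)` `dV`-a.e.
[cite: Balaban1988Convergent, (3.1) p.264; Balaban1987RG1, (0.13) p.254] -/
theorem transportOfRecord_comp_gaugeAct_mul_ae_eq {K k : ℕ} (hk : k < K)
    {ρ : Density (F.P K) k (SU N)} (hρ : FineGaugeInvariant ρ) (hρi : Integrable ρ (fieldMeasure (F.P K) k (SU N)))
    {f : GaugeField (F.P K) k (SU N) → ℝ} (hfm : Measurable f) {C : ℝ} (hfb : ∀ U, |f U| ≤ C)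
    {u : GaugeTransf (F.P K) k (SU N)} (hu : FineGauge u) :
    transportOfRecord F N K k (fun U => f (gaugeAct u U) * ρ U) =ᵐ[fieldMeasure (F.P K) (k + 1) (SU N)]
      transportOfRecord F N K k (fun U => f U * ρ U) :=
  transportK_comp_gaugeAct_mul_ae_eq (avOfRecord_measurable F N K k) (avOfRecord_haarAC F N K k hk)
    (fun _ hu U => avOfRecord_gaugeAct_of_fineGauge F N hk hu U) hρ hρi hfm hfb hu

/-- ★★★ **THE FINE-GAUGE ORBIT-AVERAGE LAW OF THE TRANSPORT OF RECORD**: for `k < K`, a fine-gauge-invariant integrable `ρ` and a bounded measurable `f`,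
`transportOfRecord k (f·ρ) = transportOfRecord k (f^{av}·ρ)` `dV`-a.e., `f^{av}(U) = ∫∏dg f(U^{u_g})` the average over the fine gauge orbit of `U`.
[cite: Balaban1988Convergent, (3.1) p.264, (1.5)–(1.6) p.247; Balaban1987RG1, (0.13)–(0.16) pp.254–255] -/
theorem transportOfRecord_mul_ae_eq_fineOrbitAvg_mul {K k : ℕ} (hk : k < K)
    {ρ : Density (F.P K) k (SU N)} (hρ : FineGaugeInvariant ρ) (hρi : Integrable ρ (fieldMeasure (F.P K) k (SU N)))
    {f : GaugeField (F.P K) k (SU N) → ℝ} (hfm : Measurable f) {C : ℝ} (hfb : ∀ U, |f U| ≤ C) :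
    transportOfRecord F N K k (fun U => f U * ρ U) =ᵐ[fieldMeasure (F.P K) (k + 1) (SU N)]
      transportOfRecord F N K k (fun U =>
        (∫ g, f (gaugeAct (fineTransf g) U) ∂Measure.pi (fun _ : FPIdx (F.P K) k => (HaarData.haar : Measure (SU N)))) * ρ U) :=
  transportK_mul_ae_eq_transportK_fineOrbitAvg_mul (succ_le_m_add_K_of_lt F hk) (avOfRecord_measurable F N K k) (avOfRecord_haarAC F N K k hk)
    (fun _ hu U => avOfRecord_gaugeAct_of_fineGauge F N hk hu U) hρ hρi hfm hfb

/-- ★★★ **THE SAME FOR A `V′`-DEPENDENT FACTOR ON THE DIAGONAL** (def-T's (†) shape): for `k < K`, `ρ` fine-gauge-invariant integrable, `f(U,V′)` jointly measurable and bounded,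
`(V′ ↦ transportOfRecord k (f(·,V′)·ρ) V′) =ᵐ (V′ ↦ transportOfRecord k (f^{av}(·,V′)·ρ) V′)`. [cite: Balaban1988Convergent, (3.1) p.264, (3.3) p.265] -/
theorem transportOfRecord_family_mul_ae_eq_fineOrbitAvg {K k : ℕ} (hk : k < K)
    {ρ : Density (F.P K) k (SU N)} (hρ : FineGaugeInvariant ρ) (hρi : Integrable ρ (fieldMeasure (F.P K) k (SU N)))
    {f : GaugeField (F.P K) k (SU N) → GaugeField (F.P K) (k + 1) (SU N) → ℝ}
    (hfm : Measurable fun p : GaugeField (F.P K) k (SU N) × GaugeField (F.P K) (k + 1) (SU N) => f p.1 p.2) {C : ℝ} (hfb : ∀ U V, |f U V| ≤ C) :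
    (fun V => transportOfRecord F N K k (fun U => f U V * ρ U) V) =ᵐ[fieldMeasure (F.P K) (k + 1) (SU N)]
      fun V => transportOfRecord F N K k (fun U =>
        (∫ g, f (gaugeAct (fineTransf g) U) V ∂Measure.pi (fun _ : FPIdx (F.P K) k => (HaarData.haar : Measure (SU N)))) * ρ U) V :=
  transportK_family_mul_ae_eq_fineOrbitAvg (succ_le_m_add_K_of_lt F hk) (avOfRecord_measurable F N K k) (avOfRecord_haarAC F N K k hk)
    (fun _ hu U => avOfRecord_gaugeAct_of_fineGauge F N hk hu U) hρ hρi hfm hfb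

/-- **… AGAINST ANY RIGHT-HAND SIDE AND SUPPORT CONDITION**: «`transportOfRecord k (f(·,V′)·ρ) V′ = 𝒩(V′)` for a.e. `V′` with `χ(V′) ≠ 0`» ⟺ the same with `f ↦ f^{av}` — the
shape of def-T's (O3′)-type clauses (`slot_{k+1}(s′) ≡ 0 ∨ ∀ᵐ V′, χ_{k+1}(s′)V′ ≠ 0 → …`). [cite: Balaban1988Convergent, (3.1) p.264, (3.25) p.270] -/
theorem ae_imp_transportOfRecord_family_eq_iff_fineOrbitAvg {K k : ℕ} (hk : k < K)
    {ρ : Density (F.P K) k (SU N)} (hρ : FineGaugeInvariant ρ) (hρi : Integrable ρ (fieldMeasure (F.P K) k (SU N)))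
    {f : GaugeField (F.P K) k (SU N) → GaugeField (F.P K) (k + 1) (SU N) → ℝ}
    (hfm : Measurable fun p : GaugeField (F.P K) k (SU N) × GaugeField (F.P K) (k + 1) (SU N) => f p.1 p.2) {C : ℝ} (hfb : ∀ U V, |f U V| ≤ C)
    (χ 𝒩 : GaugeField (F.P K) (k + 1) (SU N) → ℝ) :
    (∀ᵐ V ∂fieldMeasure (F.P K) (k + 1) (SU N), χ V ≠ 0 → transportOfRecord F N K k (fun U => f U V * ρ U) V = 𝒩 V) ↔
      ∀ᵐ V ∂fieldMeasure (F.P K) (k + 1) (SU N), χ V ≠ 0 →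
        transportOfRecord F N K k (fun U =>
          (∫ g, f (gaugeAct (fineTransf g) U) V ∂Measure.pi (fun _ : FPIdx (F.P K) k => (HaarData.haar : Measure (SU N)))) * ρ U) V = 𝒩 V :=
  ae_imp_transportK_family_eq_iff_fineOrbitAvg (succ_le_m_add_K_of_lt F hk) (avOfRecord_measurable F N K k) (avOfRecord_haarAC F N K k hk)
    (fun _ hu U => avOfRecord_gaugeAct_of_fineGauge F N hk hu U) hρ hρi hfm hfb χ 𝒩

/-- `ρ₀ = e^{−E}e^{−A∕g₀²}` of record is gauge invariant (Wilson action), in particular fine-gauge invariant. [cite: Balaban1988Convergent, Thm 1 p.262 (bookkeeping)] -/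
theorem fineGaugeInvariant_rhoZeroOfRecord (K : ℕ) (g₀ E : ℝ) : FineGaugeInvariant (rhoZeroOfRecord F N K g₀ E) :=
  B12FaddeevPopov016.fineGaugeInvariant_of_gaugeInvariant fun u U => by
    simp only [rhoZeroOfRecord, Missing.boltzmann, B14Eq16FaddeevPopov.wilsonAction4_gaugeAct']

end Record

end Summit.QuantumFields.YangMills.Theorems.BalabanUVNodesN11TransportFineGaugeOrbitAverage

end
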